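import Summits.FinalStateConjecture.FinalStateConjecture.Theorems.EIHFluxBalanceInertialRecessionStubEndgameBasics

/-!
# Route EIHFluxBalance — crux `InertialRecession`, abstract endgame for general `N`:
# the discrete virial identity, one-level regrouping, and the Tauberian end of LEMMA C

Helper file for the crux `stmt-FinalStateConjecture-10166` (virial route, evidence note
`InertialRecession_endgame_generalN_virial.md`, §4 and §6). Mathlib-only bookkeeping:

* `virial_step_identity` — `Σ⟨p′ⱼ, ξ′ⱼ − X′⟩ − Σ⟨pⱼ, ξⱼ − X⟩ = Σ⟨p′ⱼ − pⱼ, ξ′ⱼ − X′⟩ + Σ⟨pⱼ, (ξ′ⱼ − ξⱼ) − (X′ − X)⟩` (§4).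
* `restMassCentre_sub` — for rest-mass centres, `X′ − X = (ΣM)⁻¹ Σ Mₖ(ξ′ₖ − ξₖ)` (the second sum only sees the mean displacement).
* `virial_regroup` — one level of the tree telescoping: for any map `part : ι → κ` and any centres `Y`,
  `Σⱼ⟨qⱼ, ξⱼ − X⟩ = Σ_A ⟨Q_A, Y_A − X⟩ + Σ_A Σ_{j ∈ A} ⟨qⱼ, ξⱼ − Y_A⟩`, `Q_A = Σ_{j∈A} qⱼ` (iterate over the active hierarchy).
* `tauberian_nonpos_of_virial` — the end of LEMMA C: if `|G| ≤ D` with `D(t)/t → 0`, `G(T′) − G(T) ≥ c∫σ² − ∫ε` (`ε → 0`) and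
  `K ≤ Cσ²` with `K → Kinf`, then `Kinf ≤ 0`.
-/

noncomputable section

set_option linter.dupNamespace false

open Finset Filter Topology MeasureTheory intervalIntegral

namespace Summit.FinalStateConjecture.FinalStateConjecture.Theorems.SublinearIsFree.Virial

open Literature.Geometry.Lorentzian

/-! ### The discrete virial identity -/

/-- **Virial step identity** (exact algebra): the increment of `G = Σⱼ⟨pⱼ, ξⱼ − X⟩` splits into "momentum increments paired
with the new levers" plus "old momenta paired with the relative displacements". [folklore] -/
theorem virial_step_identity {ι : Type*} (s : Finset ι) (p p' ξ ξ' : ι → E3) (X X' : E3) :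
    ∑ j ∈ s, inner ℝ (p' j) (ξ' j - X') - ∑ j ∈ s, inner ℝ (p j) (ξ j - X) =
      ∑ j ∈ s, inner ℝ (p' j - p j) (ξ' j - X') + ∑ j ∈ s, inner ℝ (p j) ((ξ' j - ξ j) - (X' - X)) := by
  rw [← Finset.sum_sub_distrib, ← Finset.sum_add_distrib]
  refine Finset.sum_congr rfl fun j _ ↦ ?_
  have h : (ξ' j - ξ j) - (X' - X) = (ξ' j - X') - (ξ j - X) := by abel
  rw [h]
  simp only [inner_sub_left, inner_sub_right]
  ring

/-- For REST-MASS centres `X = (ΣM)⁻¹ΣMₖξₖ`, `X′ = (ΣM)⁻¹ΣMₖξ′ₖ`: `X′ − X = (ΣM)⁻¹ Σ Mₖ(ξ′ₖ − ξₖ)`. [folklore] -/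
theorem restMassCentre_sub {ι : Type*} (s : Finset ι) (M : ι → ℝ) (ξ ξ' : ι → E3) :
    (∑ k ∈ s, M k)⁻¹ • ∑ k ∈ s, M k • ξ' k - (∑ k ∈ s, M k)⁻¹ • ∑ k ∈ s, M k • ξ k =
      (∑ k ∈ s, M k)⁻¹ • ∑ k ∈ s, M k • (ξ' k - ξ k) := by
  rw [← smul_sub, ← Finset.sum_sub_distrib]
  congr 1
  refine Finset.sum_congr rfl fun k _ ↦ ?_
  rw [smul_sub]

/-- The second sum of the virial step with rest-mass centres: `Σⱼ⟨pⱼ, Δξⱼ − ΔX⟩ = Σⱼ⟨pⱼ, Δξⱼ⟩ − ⟨Σⱼpⱼ, ΔX⟩`, and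
`ΔX = (ΣM)⁻¹ΣMₖΔξₖ` by `restMassCentre_sub`; so only the MEAN displacement enters. [folklore] -/
theorem sum_inner_sub_centre {ι : Type*} (s : Finset ι) (p d : ι → E3) (D : E3) :
    ∑ j ∈ s, inner ℝ (p j) (d j - D) = ∑ j ∈ s, inner ℝ (p j) (d j) - inner ℝ (∑ j ∈ s, p j) D := by
  rw [sum_inner, ← Finset.sum_sub_distrib]
  refine Finset.sum_congr rfl fun j _ ↦ ?_
  rw [inner_sub_right]

/-! ### One level of the tree telescoping -/

/-- **Regrouping** (one level of the telescoping over the active hierarchy). For any labelling `part : ι → κ` of the members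
and ANY centres `Y : κ → E3`: `Σⱼ⟨qⱼ, ξⱼ − X⟩ = Σ_A ⟨Q_A, Y_A − X⟩ + Σ_A Σ_{j : part j = A} ⟨qⱼ, ξⱼ − Y_A⟩` with
`Q_A = Σ_{part j = A} qⱼ`, the outer sums running over `A ∈ s.image part`. [folklore] -/
theorem virial_regroup' {ι κ : Type*} [DecidableEq κ] (s : Finset ι) (part : ι → κ) (q ξ : ι → E3) (X : E3)
    (Y : κ → E3) :
    ∑ j ∈ s, inner ℝ (q j) (ξ j - X) =
      ∑ A ∈ s.image part, inner ℝ (∑ j ∈ (s.filter fun j ↦ part j = A), q j) (Y A - X) +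
        ∑ A ∈ s.image part, ∑ j ∈ (s.filter fun j ↦ part j = A), inner ℝ (q j) (ξ j - Y A) := by
  classical
  rw [← Finset.sum_add_distrib]
  have hfib : ∑ j ∈ s, inner ℝ (q j) (ξ j - X) =
      ∑ A ∈ s.image part, ∑ j ∈ (s.filter fun j ↦ part j = A), inner ℝ (q j) (ξ j - X) :=
    (Finset.sum_fiberwise_of_maps_to (fun j hj ↦ Finset.mem_image_of_mem part hj) _).symm
  rw [hfib]
  refine Finset.sum_congr rfl fun A _ ↦ ?_
  rw [sum_inner, ← Finset.sum_add_distrib]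
  refine Finset.sum_congr rfl fun j hj ↦ ?_
  have h : ξ j - X = (Y A - X) + (ξ j - Y A) := by abel
  rw [h, inner_add_right]

/-! ### The Tauberian end of LEMMA C -/

/-- **Tauberian step of LEMMA C.** Let `G, D, σ₂, ε, K : ℝ → ℝ` with: `|G t| ≤ D t` and `D t ≤ η t` eventually for every
`η > 0` (i.e. `D = o(t)`); the virial inequality `c∫_T^{T′}σ₂ − ∫_T^{T′}ε ≤ G T′ − G T` for `T₀ ≤ T ≤ T′` with `ε → 0`
(both locally integrable); the two-sided energy comparison in the form `K ≤ C σ₂`; and `K → Kinf`. Then `Kinf ≤ 0`.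
(With `K ≥ 0` this is `K → 0`: confined groups are cold.) [folklore] -/
theorem tauberian_nonpos_of_virial' {G D σ₂ ε K : ℝ → ℝ} {c C Kinf T₀ : ℝ} (hc : 0 < c) (hC : 0 < C)
    (hG : ∀ t, T₀ ≤ t → |G t| ≤ D t)
    (hD : ∀ η : ℝ, 0 < η → ∀ᶠ t in atTop, D t ≤ η * t)
    (hσi : ∀ a b, IntervalIntegrable σ₂ volume a b) (hεi : ∀ a b, IntervalIntegrable ε volume a b)
    (hε : Tendsto ε atTop (𝓝 0))
    (hvir : ∀ T T', T₀ ≤ T → T ≤ T' → c * (∫ t in T..T', σ₂ t) - ∫ t in T..T', ε t ≤ G T' - G T)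
    (hKσ : ∀ t, T₀ ≤ t → K t ≤ C * σ₂ t) (hK : Tendsto K atTop (𝓝 Kinf)) : Kinf ≤ 0 := by
  by_contra hpos
  rw [not_le] at hpos
  -- thresholds
  have hK2 : ∀ᶠ t in atTop, Kinf / 2 ≤ K t := by
    have := hK.eventually (Ici_mem_nhds (by linarith : Kinf / 2 < Kinf))
    exact this
  have hε8 : ∀ᶠ t in atTop, |ε t| ≤ c * Kinf / (8 * C) := by
    have hpos' : 0 < c * Kinf / (8 * C) := by positivity
    have := (Metric.tendsto_atTop.mp hε) (c * Kinf / (8 * C)) hpos'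
    obtain ⟨T, hT⟩ := this
    filter_upwards [eventually_ge_atTop T] with t ht
    have := hT t ht
    rw [Real.dist_eq, sub_zero] at this
    exact this.le
  set η : ℝ := c * Kinf / (16 * C) with hη
  have hηpos : 0 < η := by positivity
  obtain ⟨T₁, hT₁⟩ := (((hK2.and hε8).and (hD η hηpos)).and (eventually_ge_atTop T₀)).exists_forall_of_atTop
  -- for every `T' ≥ T₁`: lower bound on the increment
  have hlow : ∀ T', T₁ ≤ T' → 3 * c * Kinf / (8 * C) * (T' - T₁) ≤ G T' - G T₁ := by
    intro T' hT'
    have h0 := hT₁ T₁ le_rfl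
    have hT₀ : T₀ ≤ T₁ := h0.2
    have hv := hvir T₁ T' hT₀ hT'
    -- `∫σ₂ ≥ (Kinf/(2C))(T' − T₁)`
    have hσ : Kinf / (2 * C) * (T' - T₁) ≤ ∫ t in T₁..T', σ₂ t := by
      have hconst : ∫ t in T₁..T', Kinf / (2 * C) = Kinf / (2 * C) * (T' - T₁) := by
        rw [intervalIntegral.integral_const, smul_eq_mul]; ring
      rw [← hconst]
      refine intervalIntegral.integral_mono_on hT' intervalIntegrable_const (hσi _ _) fun t ht ↦ ?_
      have h1 := (hT₁ t ht.1).1.1.1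
      have h2 := hKσ t (hT₀.trans ht.1)
      rw [div_le_iff₀ (by positivity)]
      nlinarith
    -- `∫ε ≤ (cKinf/(8C))(T' − T₁)`
    have hεb : ∫ t in T₁..T', ε t ≤ c * Kinf / (8 * C) * (T' - T₁) := by
      have hconst : ∫ t in T₁..T', c * Kinf / (8 * C) = c * Kinf / (8 * C) * (T' - T₁) := by
        rw [intervalIntegral.integral_const, smul_eq_mul]; ring
      rw [← hconst]
      refine intervalIntegral.integral_mono_on hT' (hεi _ _) intervalIntegrable_const fun t ht ↦ ?_
      have h1 := (hT₁ t ht.1).1.1.2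
      exact (le_abs_self _).trans h1
    have hcσ : c * (Kinf / (2 * C) * (T' - T₁)) ≤ c * ∫ t in T₁..T', σ₂ t := mul_le_mul_of_nonneg_left hσ hc.le
    have : 3 * c * Kinf / (8 * C) * (T' - T₁) = c * (Kinf / (2 * C) * (T' - T₁)) - c * Kinf / (8 * C) * (T' - T₁) := by
      ring
    linarith
  -- upper bound from `|G| ≤ D ≤ ηt`
  have hup : ∀ T', T₁ ≤ T' → G T' - G T₁ ≤ η * T' + D T₁ := by
    intro T' hT'
    have h1 := hT₁ T' hT'
    have hGT' : |G T'| ≤ D T' := hG T' h1.2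
    have hDT' : D T' ≤ η * T' := h1.1.2
    have hGT₁ : |G T₁| ≤ D T₁ := hG T₁ (hT₁ T₁ le_rfl).2
    linarith [le_abs_self (G T'), neg_abs_le (G T₁)]
  -- contradiction for large `T'`
  have hD0 : 0 ≤ D T₁ := (abs_nonneg _).trans (hG T₁ (hT₁ T₁ le_rfl).2)
  have hratio : 0 ≤ (16 * C) / (c * Kinf) := by positivity
  have hRD : 0 ≤ (16 * C) / (c * Kinf) * D T₁ := mul_nonneg hratio hD0
  have hmax : T₁ ≤ max T₁ 0 := le_max_left _ _
  have hmax0 : 0 ≤ max T₁ 0 := le_max_right _ _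
  set T' : ℝ := 2 * max T₁ 0 + (16 * C) / (c * Kinf) * D T₁ + 1 with hT'
  have hT₁' : T₁ ≤ T' := by rw [hT']; linarith
  have h1 := hlow T' hT₁'
  have h2 := hup T' hT₁'
  have hkey : 3 * c * Kinf / (8 * C) * (T' - T₁) ≤ c * Kinf / (16 * C) * T' + D T₁ := by rw [← hη]; linarith
  have hcK : 0 < c * Kinf / (16 * C) := by positivity
  -- divide through by `cK∞/(16C)`: `6(T' − T₁) ≤ T' + 16C·D T₁/(cK∞)`
  have hk2 : 6 * (T' - T₁) ≤ T' + (16 * C) / (c * Kinf) * D T₁ := by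
    have hmul : 3 * c * Kinf / (8 * C) * (T' - T₁) = (c * Kinf / (16 * C)) * (6 * (T' - T₁)) := by ring
    have hmul2 : c * Kinf / (16 * C) * T' + D T₁ = (c * Kinf / (16 * C)) * (T' + (16 * C) / (c * Kinf) * D T₁) := by
      field_simp
    rw [hmul, hmul2] at hkey
    exact le_of_mul_le_mul_left hkey hcK
  have hT'eq : T' = 2 * max T₁ 0 + (16 * C) / (c * Kinf) * D T₁ + 1 := hT'
  linarith

/-! ### Registered stubs (one-line signatures, verbatim) -/

/-- Registered stub `virial_regroup` (crux `stmt-FinalStateConjecture-10166`): one level of the tree telescoping of the virial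
term, one-line form of `virial_regroup'`. [folklore] -/
theorem virial_regroup : open Literature.Geometry.Lorentzian in ∀ {ι κ : Type*} [DecidableEq κ] (s : Finset ι) (part : ι → κ) (q ξ : ι → E3) (X : E3) (Y : κ → E3), ∑ j ∈ s, inner ℝ (q j) (ξ j - X) = ∑ A ∈ s.image part, inner ℝ (∑ j ∈ (s.filter fun j ↦ part j = A), q j) (Y A - X) + ∑ A ∈ s.image part, ∑ j ∈ (s.filter fun j ↦ part j = A), inner ℝ (q j) (ξ j - Y A) :=
  fun s part q ξ X Y ↦ virial_regroup' s part q ξ X Y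

/-- Registered stub `tauberian_nonpos_of_virial` (crux `stmt-FinalStateConjecture-10166`): the Tauberian end of LEMMA C,
one-line form of `tauberian_nonpos_of_virial'`. [folklore] -/
theorem tauberian_nonpos_of_virial : open MeasureTheory Filter Topology intervalIntegral in ∀ {G D σ₂ ε K : ℝ → ℝ} {c C Kinf T₀ : ℝ}, 0 < c → 0 < C → (∀ t, T₀ ≤ t → |G t| ≤ D t) → (∀ η : ℝ, 0 < η → ∀ᶠ t in atTop, D t ≤ η * t) → (∀ a b, IntervalIntegrable σ₂ volume a b) → (∀ a b, IntervalIntegrable ε volume a b) → Tendsto ε atTop (𝓝 0) → (∀ T T', T₀ ≤ T → T ≤ T' → c * (∫ t in T..T', σ₂ t) - ∫ t in T..T', ε t ≤ G T' - G T) → (∀ t, T₀ ≤ t → K t ≤ C * σ₂ t) → Tendsto K atTop (𝓝 Kinf) → Kinf ≤ 0 :=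
  fun hc hC hG hD hσi hεi hε hvir hKσ hK ↦ tauberian_nonpos_of_virial' hc hC hG hD hσi hεi hε hvir hKσ hK

end Summit.FinalStateConjecture.FinalStateConjecture.Theorems.SublinearIsFree.Virial

end
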